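import Summits.CriticalPhenomena.SAWScalingLimit.Theses.SAWLoopLift

/-!
# Birth skeleton (BC3) for the crux `ConformalRadiusLaw` of route `SAWLoopLift`
# (item stmt-CriticalPhenomena-4846, sub-problem `SAWScalingLimit`)

LINE `birth` — **Werner rigidity split.**  The crux asks for the explicit conformal-radius law
`Σ_{P ⊆ U, P surrounds z, P ⊄ V} x_c^{|P|} → c · log(|φ_U'(0)| / |φ_V'(0)|)` (`δ → 0⁺`) on Jordan
pairs `V ⊆ U ∋ z`.  Werner's proof of his Lemma 4 / Prop. 3 (arXiv:math/0511605, pp. 8–9) shows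
that the FORMULA carries no information beyond three structural properties of the annular mass
functional `A(U, V, z)`: additivity under nesting (his identity (+)), conformal invariance, and a
continuity under domain approximation (used with the Loewner density of compositions of radial
slit maps); non-triviality fixes `c > 0`.  We cut the crux along exactly these joints:

* `stub_scalingFunctional` (lattice → continuum, the conjectural heart = Werner 2008 §7.1 Conj. 1 +
  conformal invariance, read on annular events): the `x_c`-weighted annular polygon masses of `δℤ²`
  converge, for ALL nested pairs of disc images (bounded simply connected domains, witnessed by a
  `ConformalEquiv` from the unit disc), to a functional `L` which is conformally invariant and
  Carathéodory-kernel continuous in the inner domain (outer domain `𝔻`, point `0`);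
* `stub_latticeAdditivity` (exact, provable now): for `δ > 0` and bounded `U`, `W ⊆ V ⊆ U`,
  the annular mass of `(U, W)` is the sum of those of `(U, V)` and `(V, W)` (disjoint union of
  events; finitely many polygons in a bounded window, so the `tsum`s are finite sums);
* `stub_annulusLowerBound` (lattice, non-degeneracy): the mass of critical polygons in the unit
  disc surrounding `0` and leaving the disc of radius `1/2` is bounded below, eventually in `δ`;
* `stub_wernerRigidity` (continuum, Werner's Lemma 4 in functional form): an additive, nonnegative,
  conformally invariant, kernel-continuous functional on nested disc images with
  `L(𝔻, ½𝔻, 0) > 0` equals `c · log(‖φ'(0)‖ / ‖ψ'(0)‖)` for ONE `c > 0` (disc uniformisers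
  `φ, ψ` of `U, V` with `0 ↦ z`).

`ConformalRadiusLaw_of` (kernel-checked, no sorry): nonnegativity of `L` from `tsum_nonneg`,
additivity of `L` from `stub_latticeAdditivity` by uniqueness of limits along `𝓝[>] 0`,
positivity of `L(𝔻, ½𝔻, 0)` from `stub_annulusLowerBound` (`ge_of_tendsto`; the homothety
`w ↦ w/2` certifies that `½𝔻` is a disc image), then `stub_wernerRigidity` produces `c`, and the
crux follows on Jordan pairs because the crux's own binders `φ, ψ` witness that Jordan carriers
are disc images.

Disproof used: none on file (`ledger crux ls stmt-CriticalPhenomena-4846`: no Disproof.lean yet).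
-/

noncomputable section

namespace Summit.CriticalPhenomena.SAWScalingLimit.Cruxes.ConformalRadiusLaw.Birth

open scoped Classical Topology
open Filter Set Literature.Probability.RandomPlanarGeometry Literature.Probability.LatticeModels

/-! ### Abbreviations (verbatim the `let tr` / `let M` of the crux, with the annular event named) -/

/-- Closed-edge trace in `ℂ` of a finite edge set `E` of `ℤ²` at mesh `δ` (the crux's `let tr`). -/
def trace (δ : ℝ) (E : Finset (Sym2 (Site 2))) : Set ℂ :=
  {p : ℂ | ∃ x y : Site 2, s(x, y) ∈ E ∧ p ∈ segment ℝ (meshPoint δ x) (meshPoint δ y)}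

/-- `x_c`-weighted mass of the self-avoiding polygons of `δℤ²` whose trace satisfies `P`
(the crux's `let M`). -/
def mass (δ : ℝ) (P : Set ℂ → Prop) : ℝ :=
  ∑' E : Finset (Sym2 (Site 2)),
    (if SAW.IsPolygon (zdGraph 2) E ∧ P (trace δ E) then SAW.criticalFugacity ^ E.card else (0 : ℝ))

/-- Werner's annular event `X(V, U)` for a trace `T`: drawn in `U`, surrounds `z` (`z` off the
trace, bounded complementary component), not drawn in `V`. -/
def Annular (U V : Set ℂ) (z : ℂ) (T : Set ℂ) : Prop :=
  T ⊆ U ∧ z ∉ T ∧ Bornology.IsBounded (connectedComponentIn Tᶜ z) ∧ ¬ T ⊆ V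

/-- The annular polygon mass `δ ↦ M_δ(X(V, U), z)` of the crux. -/
def annularMass (U V : Set ℂ) (z : ℂ) (δ : ℝ) : ℝ :=
  mass δ (Annular U V z)

/-- Disc images: bounded open subsets of `ℂ` conformally equivalent to the unit disc (= bounded
simply connected domains, by the Riemann mapping theorem; Jordan carriers are disc images as soon as
a uniformiser is given, which the crux's binders provide). -/
def IsDiscImage (U : Set ℂ) : Prop :=
  IsOpen U ∧ Bornology.IsBounded U ∧ Nonempty (ConformalEquiv (Metric.ball (0 : ℂ) 1) U)

/-- Additivity under nesting of a functional on nested disc images (Werner's identity (+)). -/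
def IsAdditive (L : Set ℂ → Set ℂ → ℂ → ℝ) : Prop :=
  ∀ (U V W : Set ℂ) (z : ℂ), IsDiscImage U → IsDiscImage V → IsDiscImage W →
    W ⊆ V → V ⊆ U → z ∈ W → L U W z = L U V z + L V W z

/-- Nonnegativity of a functional on nested disc images. -/
def IsNonneg (L : Set ℂ → Set ℂ → ℂ → ℝ) : Prop :=
  ∀ (U V : Set ℂ) (z : ℂ), IsDiscImage U → IsDiscImage V → V ⊆ U → z ∈ V → 0 ≤ L U V z

/-- Conformal invariance: transporting `(U, V, z)` by a conformal equivalence `f : U → U'`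
does not change the value. -/
def IsConfInvariant (L : Set ℂ → Set ℂ → ℂ → ℝ) : Prop :=
  ∀ (U U' V : Set ℂ) (z : ℂ) (f : ConformalEquiv U U'), IsDiscImage U → IsDiscImage U' →
    IsDiscImage V → V ⊆ U → z ∈ V → L U' (f '' V) (f z) = L U V z

/-- Carathéodory-kernel continuity in the inner domain, outer domain the unit disc, point `0`:
if `Vₙ → V` in the sense of kernel convergence with respect to `0` ((K1) every compact subset of
`V` lies in `Vₙ` for large `n`; (K2) every disc about a boundary point of `V` eventually fails to
lie in `Vₙ` — Pommerenke, *Boundary behaviour of conformal maps*, §1.4), then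
`L(𝔻, Vₙ, 0) → L(𝔻, V, 0)`. -/
def IsKernelContinuous (L : Set ℂ → Set ℂ → ℂ → ℝ) : Prop :=
  ∀ (V : Set ℂ) (Vs : ℕ → Set ℂ), IsDiscImage V → (∀ n, IsDiscImage (Vs n)) →
    V ⊆ Metric.ball (0 : ℂ) 1 → (∀ n, Vs n ⊆ Metric.ball (0 : ℂ) 1) →
    (0 : ℂ) ∈ V → (∀ n, (0 : ℂ) ∈ Vs n) →
    (∀ K : Set ℂ, IsCompact K → K ⊆ V → ∀ᶠ n in atTop, K ⊆ Vs n) →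
    (∀ p ∈ frontier V, ∀ r : ℝ, 0 < r → ∀ᶠ n in atTop, ¬ Metric.ball p r ⊆ Vs n) →
    Tendsto (fun n => L (Metric.ball (0 : ℂ) 1) (Vs n) 0) atTop
      (𝓝 (L (Metric.ball (0 : ℂ) 1) V 0))

/-! ### The stub statements (named `Prop`s) -/

/-- STUB A1 statement — **scaling functional**: the annular `x_c`-polygon masses of `δℤ²` converge, for
every nested pair of disc images `V ⊆ U ∋ z`, to a functional `L(U, V, z)` which is conformally invariant
and kernel-continuous in the inner domain. -/
def ScalingFunctional : Prop :=
  ∃ L : Set ℂ → Set ℂ → ℂ → ℝ,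
    (∀ (U V : Set ℂ) (z : ℂ), IsDiscImage U → IsDiscImage V → V ⊆ U → z ∈ V →
        Tendsto (annularMass U V z) (𝓝[>] 0) (𝓝 (L U V z))) ∧
    IsConfInvariant L ∧ IsKernelContinuous L

/-- STUB A2 statement — **exact lattice additivity** of the annular masses under nesting (`δ > 0`,
bounded outer set). -/
def LatticeAdditivity : Prop :=
  ∀ (δ : ℝ) (U V W : Set ℂ) (z : ℂ), 0 < δ → Bornology.IsBounded U → W ⊆ V → V ⊆ U →
    annularMass U W z δ = annularMass U V z δ + annularMass V W z δ

/-- STUB A3 statement — **annulus lower bound**: eventually in `δ`, the critical polygon mass of the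
unit disc around `0` leaving the disc of radius `1/2` is at least some `m > 0`. -/
def AnnulusLowerBound : Prop :=
  ∃ m : ℝ, 0 < m ∧ ∀ᶠ δ in 𝓝[>] (0 : ℝ),
    m ≤ annularMass (Metric.ball (0 : ℂ) 1) (Metric.ball (0 : ℂ) 2⁻¹) 0 δ

/-- STUB B statement — **Werner rigidity**: an additive, nonnegative, conformally invariant,
kernel-continuous functional on nested disc images with `L(𝔻, ½𝔻, 0) > 0` is `c · log` of the ratio of
conformal radii, for one `c > 0`. -/
def WernerRigidity : Prop :=
  ∀ L : Set ℂ → Set ℂ → ℂ → ℝ, IsAdditive L → IsNonneg L → IsConfInvariant L →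
    IsKernelContinuous L → 0 < L (Metric.ball (0 : ℂ) 1) (Metric.ball (0 : ℂ) 2⁻¹) 0 →
    ∃ c : ℝ, 0 < c ∧ ∀ (U V : Set ℂ) (z : ℂ)
      (φ : ConformalEquiv (Metric.ball (0 : ℂ) 1) U) (ψ : ConformalEquiv (Metric.ball (0 : ℂ) 1) V),
      IsOpen U → Bornology.IsBounded U → IsOpen V → V ⊆ U → z ∈ V → φ 0 = z → ψ 0 = z →
      L U V z = c * Real.log (‖deriv φ 0‖ / ‖deriv ψ 0‖)

/-! ### The stubs (the ONLY sorries of this file) -/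

/-- **stub_scalingFunctional** (lattice → continuum; the conjectural heart; L-sized).
The annular `x_c`-polygon masses of `δℤ²` have a scaling limit `L(U, V, z)` for every nested pair
of disc images `V ⊆ U ∋ z`, and the limit functional is conformally invariant and kernel-continuous
in the inner domain.  This is Werner's Conjecture 1 (arXiv:math/0511605 §7.1: the `x_c`-SAP gas on
`δℤ²` converges; "if the limit is conformally invariant it is `cμ`") read on the annular events of
his Prop. 3, WITHOUT the explicit formula and without a constant: if the polygon gas converges to
`c ×` Werner's measure then `L = c log(CR(U,z)/CR(V,z))`, which is invariant (Prop. 3 holds for all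
simply connected `D̃ ⊂ D`) and kernel-continuous (Carathéodory kernel theorem, Pommerenke Thm 1.8;
tree: `CaratheodoryKernel.tendsto_deriv`).  Why it might fail: as for the crux (no conformally
invariant scaling limit, Beffara-type anisotropy); the extension from Jordan pairs to all bounded
simply connected pairs adds the faithfulness of the discrete event `{P ⊆ U}` for rough `∂U`.
Leans on: `SAW.IsPolygon`, `SAW.criticalFugacity`, `ConformalEquiv`.
[sources: Werner2008SelfAvoidingLoops §7.1 Conj. 1, Prop. 3; LawlerSchrammWerner2004SAW §4.4] -/
theorem stub_scalingFunctional : ScalingFunctional := by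
  sorry

/-- **stub_latticeAdditivity** (exact lattice identity, provable now; S/M-sized).
Werner's identity (+) holds EXACTLY on the lattice: for `δ > 0`, bounded `U` and `W ⊆ V ⊆ U`,
a polygon drawn in `U` surrounding `z` and not drawn in `W` either is not drawn in `V`, or is drawn
in `V` and not in `W` (disjointly), so `M_δ(X(W,U)) = M_δ(X(V,U)) + M_δ(X(W,V))`.  The only
analytic point is that both `tsum`s are finite sums: a polygon with trace in the bounded set `U`
has all its vertices in the finite box `{x : δx ∈ U}` (this is where `0 < δ` and boundedness enter;
at `δ = 0` every trace is `{0}` and the sums are not summable).  No hypothesis on `z` is needed.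
Leans on: `tsum_add`, `summable_of_finite_support`/`tsum_eq_sum`, `SAW.IsPolygon`.
[sources: Werner2008SelfAvoidingLoops p. 8, identity (+); MadrasSlade1993 Def. 3.2.1] -/
theorem stub_latticeAdditivity : LatticeAdditivity := by
  sorry

/-- **stub_annulusLowerBound** (lattice non-degeneracy; M-sized).
The critical polygon gas charges a macroscopic annulus uniformly in the mesh: for some `m > 0` and
all small `δ > 0`, the `x_c`-weighted number of self-avoiding polygons of `δℤ²` drawn in the unit
disc, surrounding `0` and not drawn in the disc of radius `1/2` is at least `m`.  A consequence of
the crux (limit `c log 2 > 0`), much weaker than it; expected from bridge/unfolding lower bounds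
for polygons (Madras–Slade Ch. 3, Kesten's pattern and bridge theory; on the hexagonal lattice the
divergence of the critical bridge generating function is Duminil-Copin–Smirnov 2012 §3), but a
UNIFORM-in-`δ` lower bound for `μ^{-|P|}`-weighted polygons around a fixed hole is not in print
for `ℤ²` — why it might fail: only `p_n ≥ μ^n e^{-C√n}` is known, which does not sum to a uniform
bound.  Leans on: `SAW.IsPolygon`, `SAW.criticalFugacity`, `DKY2014_lem5`-type unfolding bounds.
[sources: MadrasSlade1993 §3.2; DuminilCopinSmirnov2012 §3; DuminilCopinKozmaYadin2014 Lemma 5] -/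
theorem stub_annulusLowerBound : AnnulusLowerBound := by
  sorry

/-- **stub_wernerRigidity** (continuum; Werner's Lemma 4 / Prop. 3 in functional form; L-sized,
the hardest PROVABLE stub).  Let `L` be a functional on nested disc images which is additive under
nesting, nonnegative, conformally invariant and kernel-continuous in the inner domain, with
`L(𝔻, ½𝔻, 0) > 0`.  Then there is ONE constant `c > 0` with
`L(U, V, z) = c · log(‖φ'(0)‖ / ‖ψ'(0)‖)` for all disc uniformisers `φ : 𝔻 → U`, `ψ : 𝔻 → V`
with `φ(0) = ψ(0) = z` (`= c log Φ'_{V→U}(z)`, the log-ratio of conformal radii).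
Proof in print (arXiv:math/0511605 pp. 8–9, for the functional `A(φ_U) = L(𝔻, U, 0)`):
(+) `A(φ_V ∘ φ_U) = A(φ_U) + A(φ_V)` from additivity + invariance; on the radial slit discs
`U_t = 𝔻 ∖ [r_t, 1)` (a composition semigroup by symmetry) `t ↦ A(φ_{U_t})` is additive and
monotone (additivity + nonnegativity), hence `= c t`; rotation invariance; so `A = c log φ'(0)` on
the semigroup generated by the slit maps; that semigroup is dense (radial Loewner–Kufarev with
piecewise-constant Dirac driving: locally uniform convergence of the maps, i.e. KERNEL convergence
of the domains — Werner's "increasing family" remark is replaced by the kernel-continuity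
hypothesis, Pommerenke Thm 1.8), and `log φ'_{U_n}(0) → log φ'_U(0)`; `c > 0` from
`L(𝔻, ½𝔻, 0) > 0`; the general pair `(U, V, z)` is moved to `(𝔻, φ⁻¹V, 0)` by invariance and the
chain rule gives `CR(φ⁻¹V, 0) = ‖ψ'(0)‖/‖φ'(0)‖`.  Why it might fail (as a Lean target, not
mathematically): needs radial Loewner density and disc automorphisms/slit maps as `ConformalEquiv`s
(tree has the chordal analogue `LoewnerSemigroup`, `CaratheodoryKernel.*`, `conformalRadius`).
[sources: Werner2008SelfAvoidingLoops Lemma 4, Prop. 3 (pp. 7–9); PommerenkeBBCM1992 Thm 1.8;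
Lawler2005 Ch. 4 (radial Loewner)] -/
theorem stub_wernerRigidity : WernerRigidity := by
  sorry

/-! ### Name-keyed aliases of the stub statements (hypotheses of the composition)

The skeleton audit admits a hypothesis of `ConformalRadiusLaw_of` iff its head constant is a registered
obligation or is NAMED like a declared stub; `__Registered.stub_X` is the statement of `stub_X` under that
name (device of `Cruxes/AxiomsOfLimit/Lines/birth.lean`). Each alias is `rfl`-equal to its statement. -/
namespace __Registered

/-- Alias of `ScalingFunctional` keyed by the registered stub name. -/
abbrev stub_scalingFunctional : Prop := ScalingFunctional
/-- Alias of `LatticeAdditivity` keyed by the registered stub name. -/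
abbrev stub_latticeAdditivity : Prop := LatticeAdditivity
/-- Alias of `AnnulusLowerBound` keyed by the registered stub name. -/
abbrev stub_annulusLowerBound : Prop := AnnulusLowerBound
/-- Alias of `WernerRigidity` keyed by the registered stub name. -/
abbrev stub_wernerRigidity : Prop := WernerRigidity

end __Registered

/-! ### Assembly (kernel-checked) -/

/-- The homothety `w ↦ w/2` of the unit disc onto the disc of radius `1/2`, as a conformal
equivalence (certifies that `½𝔻` is a disc image in the non-triviality step). -/
def halfBallEquiv : ConformalEquiv (Metric.ball (0 : ℂ) 1) (Metric.ball (0 : ℂ) 2⁻¹) where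
  toFun w := 2⁻¹ * w
  invFun w := 2 * w
  source := Metric.ball (0 : ℂ) 1
  target := Metric.ball (0 : ℂ) 2⁻¹
  map_source' := by
    intro w hw
    simp only [Metric.mem_ball, dist_zero_right, norm_mul, norm_inv, Complex.norm_ofNat] at hw ⊢
    nlinarith [norm_nonneg w]
  map_target' := by
    intro w hw
    simp only [Metric.mem_ball, dist_zero_right, norm_mul, Complex.norm_ofNat] at hw ⊢
    nlinarith [norm_nonneg w]
  left_inv' := by
    intro w _
    ring
  right_inv' := by
    intro w _
    ring
  source_eq := rfl
  target_eq := rfl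
  differentiableOn := (differentiable_id.const_mul _).differentiableOn
  differentiableOn_symm := (differentiable_id.const_mul _).differentiableOn

/-- The lattice masses are nonnegative (`x_c = 1/μ ≥ 0`). -/
theorem mass_nonneg (δ : ℝ) (P : Set ℂ → Prop) : 0 ≤ mass δ P := by
  have hxc : 0 ≤ SAW.criticalFugacity := by
    unfold SAW.criticalFugacity SAW.connectiveConstant
    exact inv_nonneg.2 (Real.iInf_nonneg fun n => Real.rpow_nonneg (Nat.cast_nonneg _) _)
  refine tsum_nonneg fun E => ?_
  split_ifs
  · exact pow_nonneg hxc _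
  · exact le_rfl

/-- **Assembly.** The four stubs imply the crux `ConformalRadiusLaw` of route `SAWLoopLift`
(concluded BY NAME; hypotheses keyed by the registered stub names). -/
theorem ConformalRadiusLaw_of (hA1 : __Registered.stub_scalingFunctional)
    (hA2 : __Registered.stub_latticeAdditivity) (hA3 : __Registered.stub_annulusLowerBound)
    (hB : __Registered.stub_wernerRigidity) :
    Summit.CriticalPhenomena.SAWScalingLimit.Theses.SAWLoopLift.ConformalRadiusLaw := by
  obtain ⟨L, hlim, hinv, hcont⟩ := hA1
  -- nonnegativity of the limit functional, from nonnegativity of the lattice masses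
  have hL_nonneg : IsNonneg L := by
    intro U V z hU hV hVU hz
    exact ge_of_tendsto' (hlim U V z hU hV hVU hz) fun δ => mass_nonneg δ _
  -- additivity of the limit functional, from exact lattice additivity and uniqueness of limits
  have hL_add : IsAdditive L := by
    intro U V W z hU hV hW hWV hVU hz
    have h1 : Tendsto (annularMass U W z) (𝓝[>] 0) (𝓝 (L U W z)) :=
      hlim U W z hU hW (hWV.trans hVU) hz
    have h2 : Tendsto (fun δ => annularMass U V z δ + annularMass V W z δ) (𝓝[>] 0)
        (𝓝 (L U V z + L V W z)) :=
      (hlim U V z hU hV hVU (hWV hz)).add (hlim V W z hV hW hWV hz)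
    have heq : (fun δ => annularMass U V z δ + annularMass V W z δ) =ᶠ[𝓝[>] 0]
        annularMass U W z := by
      filter_upwards [self_mem_nhdsWithin] with δ hδ
      exact (hA2 δ U V W z hδ hU.2.1 hWV hVU).symm
    exact tendsto_nhds_unique h1 (h2.congr' heq)
  -- non-triviality, from the annulus lower bound
  have hball : IsDiscImage (Metric.ball (0 : ℂ) 1) :=
    ⟨Metric.isOpen_ball, Metric.isBounded_ball, ⟨ConformalEquiv.refl _⟩⟩
  have hhalf : IsDiscImage (Metric.ball (0 : ℂ) 2⁻¹) :=
    ⟨Metric.isOpen_ball, Metric.isBounded_ball, ⟨halfBallEquiv⟩⟩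
  have hsub : Metric.ball (0 : ℂ) 2⁻¹ ⊆ Metric.ball (0 : ℂ) 1 :=
    Metric.ball_subset_ball (by norm_num)
  have h0 : (0 : ℂ) ∈ Metric.ball (0 : ℂ) 2⁻¹ := Metric.mem_ball_self (by norm_num)
  have hpos : 0 < L (Metric.ball (0 : ℂ) 1) (Metric.ball (0 : ℂ) 2⁻¹) 0 := by
    obtain ⟨m, hm, hev⟩ := hA3
    exact hm.trans_le (ge_of_tendsto (hlim _ _ _ hball hhalf hsub h0) hev)
  -- Werner rigidity produces the constant
  obtain ⟨c, hc, hformula⟩ := hB L hL_add hL_nonneg hinv hcont hpos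
  -- the crux on Jordan pairs: the binders `φ`, `ψ` witness that Jordan carriers are disc images
  unfold Summit.CriticalPhenomena.SAWScalingLimit.Theses.SAWLoopLift.ConformalRadiusLaw
  intro tr M
  refine ⟨c, hc, ?_⟩
  intro U V z φ ψ hVU hz hφ hψ
  have key := hlim U.carrier V.carrier z ⟨U.isOpen, U.isBounded, ⟨φ⟩⟩
    ⟨V.isOpen, V.isBounded, ⟨ψ⟩⟩ hVU hz
  rw [hformula U.carrier V.carrier z φ ψ U.isOpen U.isBounded V.isOpen hVU hz hφ hψ] at key
  exact key

/-- Wiring check (an `example`, so that `ConformalRadiusLaw_of` stays the only theorem concluding the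
crux): the registered stubs feed the composition as stated. -/
example : Summit.CriticalPhenomena.SAWScalingLimit.Theses.SAWLoopLift.ConformalRadiusLaw :=
  ConformalRadiusLaw_of stub_scalingFunctional stub_latticeAdditivity stub_annulusLowerBound
    stub_wernerRigidity

end Summit.CriticalPhenomena.SAWScalingLimit.Cruxes.ConformalRadiusLaw.Birth

end
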